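/-
Width seat `ym-line-cbag-p1-w3` (prover-ym-line-cbag-p1-w3-g2-0), route `ColdBoxAllGroups`, crux `BulkAllGroups`
(stmt-QuantumFields-22255), line `dlr-chessboard-G` (lead `ym-line-cbag-p2`, PLAN v6 work package «w3 — draft StubKernelMeanExpansionG»).
-/
import Summits.QuantumFields.YangMills.Theorems.ColdBoxAllGroupsBulkAllGroupsKernelMeanDatumCoreG
import Summits.QuantumFields.YangMills.Theorems.ColdBoxAllGroupsBulkAllGroupsKernelGoodEventTruncG
import Summits.QuantumFields.YangMills.Theorems.ColdBoxAllGroupsBulkAllGroupsGaussTailDatumG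
import Summits.QuantumFields.YangMills.Theorems.ColdBoxAllGroupsBulkAllGroupsKernelBridgeG
import Summits.QuantumFields.YangMills.Theorems.ColdBoxAllGroupsBulkAllGroupsUnitsInterfaceG
import Summits.QuantumFields.YangMills.Theorems.ColdBoxAllGroupsBoxFloorAllGroupsChartWindowG
import Summits.QuantumFields.YangMills.Theorems.ColdBoxAllGroupsBoxFloorAllGroupsChartDensityJ
import Summits.QuantumFields.YangMills.Theorems.ColdBoxAllGroupsBoxFloorAllGroupsStubBoxDirichletDominationAbsG
import Summits.QuantumFields.YangMills.Theorems.ColdBoxAllGroupsBulkAllGroupsKernelDatumBoundsG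

/-!
# Crux `BulkAllGroups` (stmt-QuantumFields-22255), stub N2-mean-G `stub_kernelMeanExpansionG`: the ASSEMBLY of the mean expansion with datum
# for every compact group presented in `U(N)`, modulo the numeric exponent bookkeeping (PLAN v6: `eventually_kernelDatum_boundsG`, seat p1)

`G`-port of the assembly `Theorems/WeakCouplingRatesBulkDominatesColdBoxWStubKernelMeanExpansion.lean` (`SU(2)`), along PLAN v6 of the lead
(`Cruxes/BulkAllGroups/PLAN-v6.md`): parameters `δ = θ/5`, `ε = 6θ`, `H = ⌈β^θ⌉`; the datum package (`exists_datum_packageG_datVec`, this seat: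
constants `Ca, CE`, exterior radius `r = Ca·β^{3θ+θ/5−1/2}`, energy `B = CE(2H+3)⁴β^{2δ−1}`); the link window `L = (12H²+2H+1)(√2·√(β^{2ε−1}) + 8r)`,
`m = 2L` (von Neumann radius `η₀(ρ)` of `linkWindow_subset_image_expChart`); Helgason's Jacobian `J` of the chart (`r₂, C₂, cH`,
`exists_chartMeasureE_restrict_closedBall_eq_withDensity`), `ℓ = 2C₂m²`, `τ = 190βm³`, tilt size `w = 120(2H+1)⁴τ + 4(2H+1)⁴ℓ`; Gaussian
threshold `R = β^ε/(4(√D+1))`, background bound `R' = √(βB) + 4√β·r` (`abs_dirBackground_sdatE_le`, seat p1), sandwich radius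
`mE = √D(12H²+2H+1)((R+R') + 4√β r)/√β`, Gaussian bad mass `P = 240D(2H+1)⁴e^{−R²/2}` (`gaussD_real_compl_goodTDE_inter_ball_le`, seat w2), YM bad mass
`pY = e^{−β^ε}` at the charted configuration (`boxKernelG_real_coldGoodSetG_compl_le_trunc`, lead), `M = β^{2ε}`.

* **`kernelMeanExpansionG_of_bounds`** — for a faithful continuous unitary `ρ : G →* U(N)` (`N ≥ 1`) and `0 < θ ≤ 1/44`: IF the numeric facts
  hold eventually in `β` for all positive constants `Ca CE r₂ C₂ η₀` (hypothesis `hnum`, the MEAN half of PLAN v6's `eventually_kernelDatum_boundsG`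
  verbatim: `1 ≤ β`, `L ≤ η₀`, `m ≤ 1/4`, `m ≤ r₂`, `mE ≤ m`, `r ≤ m`, the cost window `(D/2)(R+R')²/β + 190m³ < β^{2ε−1}`, `P ≤ 1/2`, and
  `MEAN-RHS = 2(2Nβ)pY + M(e^{2w}−1) + τ + 2(1+2D²(R'⁴+3))√P ≤ β^{−θ}`), THEN `KernelMeanExpansionG ρ θ (θ/5)`.
  Chain: the lead's deterministic mean core with datum `abs_kernelMeanG_sub_gaussian_le_datum` at the forest-gauged truncated gauge copy `W` of the
  crude-good `ω` (its `(hWb)`, `(hSur)` from w2's `abs_tiltWDE_le_of_window` / `abs_qObsDE_sub_beta_mul_plaqCostAt_le`, `(hP)` from w2's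
  `gaussD_real_compl_goodTDE_inter_ball_le`, `(hF)` from p1's `abs_dirBackground_sdatE_le`, `(hpY)` from the lead's
  `boxKernelG_real_coldGoodSetG_compl_le_trunc`, `hball` from `linkWindow_subset_image_expChart`, the density from Helgason's `J`), transported back
  to `ω` by the kernel bridge `integral_plaqCostAt_boxKernelG_eq_of_gauge_trunc_of_near_centre` (w2), and converted to the interface's units by
  `half_sum_sq_dirBackground_sdatE_eq` (U1): the interface's datum is `ϑI = (√2)⁻¹•ϑ` with competitor `(√2)⁻¹•s` (energy clause
  `sum_formM_interface_le`, same `CE`).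
The registered stub BY NAME then follows from p1's `eventually_kernelDatum_boundsG` in three lines (lead's integration).  No sorry; no new
definition; standard axioms.  NOT a claim about the mass gap: rung-level support (R2xi-G `XiPow`, RECORD label); the Yang–Mills mass gap is NOT
proved by any of this.
-/

set_option autoImplicit false

noncomputable section

open MeasureTheory ProbabilityTheory Finset Real Filter Topology Metric
open scoped ENNReal Matrix.Norms.Frobenius
open Literature.Probability.LatticeModels (Site glueWith glueWith_apply_mem glueWith_apply_not_mem)
open Literature.MathematicalPhysics.QuantumLattice
open Literature.MathematicalPhysics.QuantumFieldTheory
open Literature.MathematicalPhysics.QuantumFieldTheory.LatticeMaxwell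
open Literature.MathematicalPhysics.QuantumFieldTheory.AxialGauge
open Summit.QuantumFields.YangMills.Theorems.WeakCouplingRates
open Summit.QuantumFields.YangMills.Theorems.FreeEnergyLogCoefficient

namespace Summit.QuantumFields.YangMills.Theorems.ColdBoxAllGroups

variable {N : ℕ} [NeZero N] {G : Type} [Group G] [TopologicalSpace G] [IsTopologicalGroup G] [CompactSpace G]
  [MeasurableSpace G] [BorelSpace G]
variable (ρ : G →* Matrix (Fin N) (Fin N) ℂ)

set_option maxHeartbeats 1600000 in
/-- **The mean expansion with datum for every compact group presented in `U(N)`, modulo the numeric bookkeeping** (PLAN v6): for a faithful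
continuous unitary `ρ` (`N ≥ 1`) and `0 < θ ≤ 1/44`, the MEAN half of `eventually_kernelDatum_boundsG` (hypothesis `hnum`, for all positive
constants `Ca CE r₂ C₂ η₀`; see the module docstring for the dictionary) implies `KernelMeanExpansionG ρ θ (θ/5)`. -/
theorem kernelMeanExpansionG_of_bounds (hρc : Continuous ρ) (hinj : Function.Injective ρ)
    (hρu : ∀ g, ρ g ∈ Matrix.unitaryGroup (Fin N) ℂ) {θ : ℝ} (hθ : 0 < θ) (hθ1 : θ ≤ 1 / 44)
    (hnum : ∀ Ca CE r₂ C₂ η₀ : ℝ, 0 < Ca → 0 < CE → 0 < r₂ → 0 < C₂ → 0 < η₀ → ∀ᶠ β : ℝ in atTop,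
      1 ≤ β ∧
      -- the link window is inside von Neumann's radius: `L ≤ η₀`
      (12 * (⌈β ^ θ⌉₊ : ℝ) ^ 2 + 2 * ⌈β ^ θ⌉₊ + 1) *
          (Real.sqrt 2 * Real.sqrt (β ^ (2 * (6 * θ) - 1)) + 8 * (Ca * β ^ (3 * θ + θ / 5 - 1 / 2))) ≤ η₀ ∧
      -- `m = 2L ≤ 1/4`, `m ≤ r₂`
      2 * ((12 * (⌈β ^ θ⌉₊ : ℝ) ^ 2 + 2 * ⌈β ^ θ⌉₊ + 1) *
          (Real.sqrt 2 * Real.sqrt (β ^ (2 * (6 * θ) - 1)) + 8 * (Ca * β ^ (3 * θ + θ / 5 - 1 / 2)))) ≤ 1 / 4 ∧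
      2 * ((12 * (⌈β ^ θ⌉₊ : ℝ) ^ 2 + 2 * ⌈β ^ θ⌉₊ + 1) *
          (Real.sqrt 2 * Real.sqrt (β ^ (2 * (6 * θ) - 1)) + 8 * (Ca * β ^ (3 * θ + θ / 5 - 1 / 2)))) ≤ r₂ ∧
      -- the sandwich radius: `mE ≤ m`
      Real.sqrt (dimE ρ) * ((12 * (⌈β ^ θ⌉₊ : ℝ) ^ 2 + 2 * ⌈β ^ θ⌉₊ + 1) *
          ((β ^ (6 * θ) / (4 * (Real.sqrt (dimE ρ) + 1)) +
              (Real.sqrt (β * (CE * (2 * (⌈β ^ θ⌉₊ : ℝ) + 3) ^ 4 * β ^ (2 * (θ / 5) - 1))) +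
                4 * (Real.sqrt β * (Ca * β ^ (3 * θ + θ / 5 - 1 / 2))))) +
            4 * (Real.sqrt β * (Ca * β ^ (3 * θ + θ / 5 - 1 / 2))))) / Real.sqrt β ≤
        2 * ((12 * (⌈β ^ θ⌉₊ : ℝ) ^ 2 + 2 * ⌈β ^ θ⌉₊ + 1) *
          (Real.sqrt 2 * Real.sqrt (β ^ (2 * (6 * θ) - 1)) + 8 * (Ca * β ^ (3 * θ + θ / 5 - 1 / 2)))) ∧
      -- `r ≤ m`
      Ca * β ^ (3 * θ + θ / 5 - 1 / 2) ≤
        2 * ((12 * (⌈β ^ θ⌉₊ : ℝ) ^ 2 + 2 * ⌈β ^ θ⌉₊ + 1) *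
          (Real.sqrt 2 * Real.sqrt (β ^ (2 * (6 * θ) - 1)) + 8 * (Ca * β ^ (3 * θ + θ / 5 - 1 / 2)))) ∧
      -- the cost window of the sandwich
      (dimE ρ : ℝ) / 2 * (β ^ (6 * θ) / (4 * (Real.sqrt (dimE ρ) + 1)) +
            (Real.sqrt (β * (CE * (2 * (⌈β ^ θ⌉₊ : ℝ) + 3) ^ 4 * β ^ (2 * (θ / 5) - 1))) +
              4 * (Real.sqrt β * (Ca * β ^ (3 * θ + θ / 5 - 1 / 2))))) ^ 2 / β +
          190 * (2 * ((12 * (⌈β ^ θ⌉₊ : ℝ) ^ 2 + 2 * ⌈β ^ θ⌉₊ + 1) *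
            (Real.sqrt 2 * Real.sqrt (β ^ (2 * (6 * θ) - 1)) + 8 * (Ca * β ^ (3 * θ + θ / 5 - 1 / 2))))) ^ 3 <
        β ^ (2 * (6 * θ) - 1) ∧
      -- the Gaussian bad mass `P ≤ 1/2`
      240 * (dimE ρ : ℝ) * (2 * (⌈β ^ θ⌉₊ : ℝ) + 1) ^ 4 *
          Real.exp (-(β ^ (6 * θ) / (4 * (Real.sqrt (dimE ρ) + 1))) ^ 2 / 2) ≤ 1 / 2 ∧
      -- MEAN-RHS ≤ β^{−θ}
      2 * (2 * N * β) * Real.exp (-(β ^ (6 * θ))) +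
          ((β ^ (2 * (6 * θ))) *
              (Real.exp (2 * (120 * (2 * (⌈β ^ θ⌉₊ : ℝ) + 1) ^ 4 *
                  (190 * β * (2 * ((12 * (⌈β ^ θ⌉₊ : ℝ) ^ 2 + 2 * ⌈β ^ θ⌉₊ + 1) *
                    (Real.sqrt 2 * Real.sqrt (β ^ (2 * (6 * θ) - 1)) + 8 * (Ca * β ^ (3 * θ + θ / 5 - 1 / 2))))) ^ 3) +
                4 * (2 * (⌈β ^ θ⌉₊ : ℝ) + 1) ^ 4 *
                  (2 * C₂ * (2 * ((12 * (⌈β ^ θ⌉₊ : ℝ) ^ 2 + 2 * ⌈β ^ θ⌉₊ + 1) *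
                    (Real.sqrt 2 * Real.sqrt (β ^ (2 * (6 * θ) - 1)) + 8 * (Ca * β ^ (3 * θ + θ / 5 - 1 / 2))))) ^ 2))) - 1) +
            190 * β * (2 * ((12 * (⌈β ^ θ⌉₊ : ℝ) ^ 2 + 2 * ⌈β ^ θ⌉₊ + 1) *
              (Real.sqrt 2 * Real.sqrt (β ^ (2 * (6 * θ) - 1)) + 8 * (Ca * β ^ (3 * θ + θ / 5 - 1 / 2))))) ^ 3 +
            2 * (1 + 2 * (dimE ρ : ℝ) ^ 2 *
                ((Real.sqrt (β * (CE * (2 * (⌈β ^ θ⌉₊ : ℝ) + 3) ^ 4 * β ^ (2 * (θ / 5) - 1))) +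
                    4 * (Real.sqrt β * (Ca * β ^ (3 * θ + θ / 5 - 1 / 2)))) ^ 4 + 3)) *
              Real.sqrt (240 * (dimE ρ : ℝ) * (2 * (⌈β ^ θ⌉₊ : ℝ) + 1) ^ 4 *
                Real.exp (-(β ^ (6 * θ) / (4 * (Real.sqrt (dimE ρ) + 1))) ^ 2 / 2))) ≤
        β ^ (-θ)) :
    KernelMeanExpansionG ρ θ (θ / 5) := by
  haveI : SecondCountableTopology (Matrix (Fin N) (Fin N) ℂ) := inferInstanceAs (SecondCountableTopology (Fin N → Fin N → ℂ))
  haveI : SecondCountableTopology G := (hρc.isClosedEmbedding hinj).isEmbedding.secondCountableTopology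
  -- exponents
  have hδ0 : (0 : ℝ) ≤ θ / 5 := by positivity
  have hwin9 : 9 * θ + θ / 5 < 1 / 2 := by linarith
  have hε : 3 * θ + θ / 5 < 6 * θ := by linarith
  -- structural inputs: the datum package, the chart density, von Neumann's radius, the YM bad mass at `W`
  obtain ⟨Ca, CE, hCa, hCE, β₁, hpack⟩ := exists_datum_packageG_datVec ρ hρc hinj hρu (θ := θ) (δ := θ / 5) hθ hδ0 hwin9
  obtain ⟨r₂, C₂, cH, hr₂, -, hC₂, hcH, J, hJc, hJb, hJhalf, hdens⟩ :=
    exists_chartMeasureE_restrict_closedBall_eq_withDensity ρ hρc hinj hρu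
  obtain ⟨η₀, hη₀, hwinη⟩ := linkWindow_subset_image_expChart ρ hρc hinj hρu
  obtain ⟨β₂, hrare⟩ := boxKernelG_real_coldGoodSetG_compl_le_trunc ρ hρu hρc (θ := θ) (δ := θ / 5) (ε := 6 * θ) hθ hδ0 hε
  obtain ⟨β₃, hnumE⟩ := Filter.eventually_atTop.1 (hnum Ca CE r₂ C₂ η₀ hCa hCE hr₂ hC₂ hη₀)
  -- the threshold
  unfold KernelMeanExpansionG
  refine ⟨CE, max β₁ (max β₂ β₃), fun β hβ ω hω => ?_⟩
  have hb₁ : β₁ ≤ β := (le_max_left _ _).trans hβ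
  have hb₂ : β₂ ≤ β := ((le_max_left _ _).trans (le_max_right _ _)).trans hβ
  have hb₃ : β₃ ≤ β := ((le_max_right _ _).trans (le_max_right _ _)).trans hβ
  obtain ⟨hβ1, hLη, hm4, hmr₂, hmEm, hrm, hwin, hP2, hfinal⟩ := hnumE β hb₃
  have hβ0 : 0 < β := by linarith
  obtain ⟨hH1r, -⟩ := one_le_ceil_rpow_and_le hβ1 hθ.le
  have hH : 1 ≤ ⌈β ^ θ⌉₊ := by exact_mod_cast hH1r
  -- the datum package and the YM bad mass at this `β`
  obtain ⟨g, ϑ, s, hW, hϑr, -, -, hforest, hs, hE⟩ := hpack β hb₁ ω hω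
  have hpY := hrare β hb₂ ω hω g
  have hpY1 : Real.exp (-(β ^ (6 * θ))) < 1 := by
    rw [Real.exp_lt_one_iff, neg_lt_zero]; exact Real.rpow_pos_of_pos hβ0 _
  -- signs of the bookkeeping quantities (`r`, `R`, `R'`, `m = 2L`, `τ`, `ℓ`)
  have hr0 : (0 : ℝ) ≤ Ca * β ^ (3 * θ + θ / 5 - 1 / 2) := by positivity
  have hR0 : (0 : ℝ) ≤ β ^ (6 * θ) / (4 * (Real.sqrt (dimE ρ) + 1)) := by positivity
  have hR'0 : (0 : ℝ) ≤ Real.sqrt (β * (CE * (2 * (⌈β ^ θ⌉₊ : ℝ) + 3) ^ 4 * β ^ (2 * (θ / 5) - 1))) +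
      4 * (Real.sqrt β * (Ca * β ^ (3 * θ + θ / 5 - 1 / 2))) := by positivity
  have hm0 := hr0.trans hrm
  have hmpos : (0 : ℝ) < 2 * ((12 * (⌈β ^ θ⌉₊ : ℝ) ^ 2 + 2 * ⌈β ^ θ⌉₊ + 1) *
      (Real.sqrt 2 * Real.sqrt (β ^ (2 * (6 * θ) - 1)) + 8 * (Ca * β ^ (3 * θ + θ / 5 - 1 / 2)))) := by
    have : 0 < Real.sqrt (β ^ (2 * (6 * θ) - 1)) := Real.sqrt_pos.2 (Real.rpow_pos_of_pos hβ0 _)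
    positivity
  have hτ0 : (0 : ℝ) ≤ 190 * β * (2 * ((12 * (⌈β ^ θ⌉₊ : ℝ) ^ 2 + 2 * ⌈β ^ θ⌉₊ + 1) *
      (Real.sqrt 2 * Real.sqrt (β ^ (2 * (6 * θ) - 1)) + 8 * (Ca * β ^ (3 * θ + θ / 5 - 1 / 2))))) ^ 3 := by positivity
  have hℓ0 : (0 : ℝ) ≤ 2 * C₂ * (2 * ((12 * (⌈β ^ θ⌉₊ : ℝ) ^ 2 + 2 * ⌈β ^ θ⌉₊ + 1) *
      (Real.sqrt 2 * Real.sqrt (β ^ (2 * (6 * θ) - 1)) + 8 * (Ca * β ^ (3 * θ + θ / 5 - 1 / 2))))) ^ 2 := by positivity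
  -- the datum in the shapes of the bricks
  have hW' : ∀ e, e ∉ boxEdges 4 (2 * ⌈β ^ θ⌉₊ + 1) → _ := fun e _ => hW e
  have hϑ' : ∀ e, e ∉ boxEdges 4 (2 * ⌈β ^ θ⌉₊ + 1) → ‖datVec ϑ e‖ ≤ Ca * β ^ (3 * θ + θ / 5 - 1 / 2) := fun e _ => hϑr e
  have hϑm : ∀ e, e ∉ boxEdges 4 (2 * ⌈β ^ θ⌉₊ + 1) → ‖datVec ϑ e‖ ≤ 2 * ((12 * (⌈β ^ θ⌉₊ : ℝ) ^ 2 + 2 * ⌈β ^ θ⌉₊ + 1) *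
      (Real.sqrt 2 * Real.sqrt (β ^ (2 * (6 * θ) - 1)) + 8 * (Ca * β ^ (3 * θ + θ / 5 - 1 / 2)))) := fun e _ => (hϑr e).trans hrm
  have hϑsq : ∀ e, e ∉ boxEdges 4 (2 * ⌈β ^ θ⌉₊ + 1) → ∑ c, ϑ c e ^ 2 ≤ (Ca * β ^ (3 * θ + θ / 5 - 1 / 2)) ^ 2 := fun e _ => by
    rw [← norm_datVec_sq]; exact pow_le_pow_left₀ (norm_nonneg _) (hϑr e) 2
  -- the interface datum `ϑI = (√2)⁻¹•ϑ` and its energy clause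
  refine ⟨fun c => (Real.sqrt 2)⁻¹ • ϑ c, fun c => (Real.sqrt 2)⁻¹ • s c, sum_formM_interface_le ϑ s hE, fun x hx => ?_⟩
  beta_reduce
  -- the plaquette `(x;1,2)` touches the cold box
  have hxt := near_centre_mem_plaquettesTouching hH hx
  -- the chart density at radius `m`
  have hgpos : ∀ a : EuclideanSpace ℝ (Fin (dimE ρ)), ‖a‖ ≤ 2 * ((12 * (⌈β ^ θ⌉₊ : ℝ) ^ 2 + 2 * ⌈β ^ θ⌉₊ + 1) *
      (Real.sqrt 2 * Real.sqrt (β ^ (2 * (6 * θ) - 1)) + 8 * (Ca * β ^ (3 * θ + θ / 5 - 1 / 2)))) → 0 < J a := fun a ha => by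
    linarith [(hJhalf a (ha.trans hmr₂)).1]
  have hg : ∀ a : EuclideanSpace ℝ (Fin (dimE ρ)), ‖a‖ ≤ 2 * ((12 * (⌈β ^ θ⌉₊ : ℝ) ^ 2 + 2 * ⌈β ^ θ⌉₊ + 1) *
      (Real.sqrt 2 * Real.sqrt (β ^ (2 * (6 * θ) - 1)) + 8 * (Ca * β ^ (3 * θ + θ / 5 - 1 / 2)))) →
      |Real.log (J a)| ≤ 2 * C₂ * (2 * ((12 * (⌈β ^ θ⌉₊ : ℝ) ^ 2 + 2 * ⌈β ^ θ⌉₊ + 1) *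
        (Real.sqrt 2 * Real.sqrt (β ^ (2 * (6 * θ) - 1)) + 8 * (Ca * β ^ (3 * θ + θ / 5 - 1 / 2))))) ^ 2 := fun a ha => by
    refine (abs_log_jacobian_le hJb hJhalf a (ha.trans hmr₂)).trans ?_
    have : ‖a‖ ^ 2 ≤ (2 * ((12 * (⌈β ^ θ⌉₊ : ℝ) ^ 2 + 2 * ⌈β ^ θ⌉₊ + 1) *
        (Real.sqrt 2 * Real.sqrt (β ^ (2 * (6 * θ) - 1)) + 8 * (Ca * β ^ (3 * θ + θ / 5 - 1 / 2))))) ^ 2 :=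
      pow_le_pow_left₀ (norm_nonneg _) ha 2
    nlinarith
  have hc0 : ENNReal.ofReal cH ≠ 0 := by rw [ENNReal.ofReal_ne_zero_iff]; exact hcH
  have hdensm := hdens _ hmpos hmr₂
  -- the link window (`hball`) at radius `m = 2L`
  have hball : ∀ u : G, ‖ρ u - 1‖ ≤ (12 * (⌈β ^ θ⌉₊ : ℝ) ^ 2 + 2 * ⌈β ^ θ⌉₊ + 1) *
      (Real.sqrt 2 * Real.sqrt (β ^ (2 * (6 * θ) - 1)) + 8 * (Ca * β ^ (3 * θ + θ / 5 - 1 / 2))) →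
      u ∈ expChart ρ '' closedBall (0 : EuclideanSpace ℝ (Fin (dimE ρ))) (2 * ((12 * (⌈β ^ θ⌉₊ : ℝ) ^ 2 + 2 * ⌈β ^ θ⌉₊ + 1) *
        (Real.sqrt 2 * Real.sqrt (β ^ (2 * (6 * θ) - 1)) + 8 * (Ca * β ^ (3 * θ + θ / 5 - 1 / 2))))) :=
    fun u hu => hwinη _ hLη u hu
  -- the scaled background bound `R'` on all plaquettes (p1)
  have hF := fun (c : Fin (dimE ρ)) (p : ZdPlaquette 4) => abs_dirBackground_sdatE_le hβ0.le hr0 hϑsq hforest s hE c p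
  -- the Gaussian bad mass (w2)
  have hPS := gaussD_real_compl_goodTDE_inter_ball_le ρ hρc (ε := 6 * θ) hβ0 hH hr0 hR0 hR'0 hϑ' hforest hF hmEm hrm hm4 hwin
  -- the tilt bound and the surrogate accuracy on the window (w2)
  have hWb : ∀ t ∈ goodTDE ρ ⌈β ^ θ⌉₊ β (6 * θ) ϑ ∩ {t | ∀ e : ColdFreeIdx ⌈β ^ θ⌉₊,
      ‖unscaleTE ⌈β ^ θ⌉₊ (dimE ρ) β (t + meanTE ⌈β ^ θ⌉₊ (dimE ρ) β ϑ) e‖ ≤ 2 * ((12 * (⌈β ^ θ⌉₊ : ℝ) ^ 2 + 2 * ⌈β ^ θ⌉₊ + 1) *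
        (Real.sqrt 2 * Real.sqrt (β ^ (2 * (6 * θ) - 1)) + 8 * (Ca * β ^ (3 * θ + θ / 5 - 1 / 2))))}, _ :=
    fun t ht => abs_tiltWDE_le_of_window ρ hρc hβ0 hm0 hm4 hg hforest hϑm t ht.2
  have hSur : ∀ t ∈ goodTDE ρ ⌈β ^ θ⌉₊ β (6 * θ) ϑ ∩ {t | ∀ e : ColdFreeIdx ⌈β ^ θ⌉₊,
      ‖unscaleTE ⌈β ^ θ⌉₊ (dimE ρ) β (t + meanTE ⌈β ^ θ⌉₊ (dimE ρ) β ϑ) e‖ ≤ 2 * ((12 * (⌈β ^ θ⌉₊ : ℝ) ^ 2 + 2 * ⌈β ^ θ⌉₊ + 1) *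
        (Real.sqrt 2 * Real.sqrt (β ^ (2 * (6 * θ) - 1)) + 8 * (Ca * β ^ (3 * θ + θ / 5 - 1 / 2))))}, _ :=
    fun t ht => abs_qObsDE_sub_beta_mul_plaqCostAt_le ρ hρc hβ0 hm0 hm4 hforest hϑm t ht.2 hxt
  -- the deterministic mean core with datum (lead), at `W`
  have hcore := abs_kernelMeanG_sub_gaussian_le_datum ρ hρc hinj hρu (ε := 6 * θ) hJc.measurable hβ1 hH hr0 hm4 hW' hϑ' hball hgpos hc0
    ENNReal.ofReal_ne_top hdensm hpY hpY1 hPS hP2 hWb (show (1 : Fin 4) < 2 by decide) hxt hSur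
    (hF · ((x, ⟨((1 : Fin 4), (2 : Fin 4)), by decide⟩) : ZdPlaquette 4))
  -- transport of the mean from `ω` to `W` (w2's bridge)
  have hmean := integral_plaqCostAt_boxKernelG_eq_of_gauge_trunc_of_near_centre ρ hρc β hH ω g hx (show (1 : Fin 4) ≠ 2 by decide)
  -- the constant term in the interface's units (U1)
  have hU1 := half_sum_sq_dirBackground_sdatE_eq (H := ⌈β ^ θ⌉₊) hβ0.le ϑ (x, 1, 2)
  rw [hmean]
  have hshape : β * (∫ U, plaqCostAt ρ x 1 2 U ∂(boxKernelG ρ β ⌈β ^ θ⌉₊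
        (forestFix ⌈β ^ θ⌉₊ (glueWith (boxEdgesAt dirCorner (2 * ⌈β ^ θ⌉₊ + 3))
          (fun e' : ↥(boxEdgesAt dirCorner (2 * ⌈β ^ θ⌉₊ + 3)) => gaugeTransformZd g ω e'.1) (fun _ => 1))))) -
        (dimE ρ : ℝ) / 2 * boxDirProjKernel ⌈β ^ θ⌉₊ (x, 1, 2) (x, 1, 2) -
        β * ∑ c, sCirc (glue (pin := fun e => e ∉ dirFreeEdges ⌈β ^ θ⌉₊) dirCorner (2 * ⌈β ^ θ⌉₊ + 3) ((Real.sqrt 2)⁻¹ • ϑ c)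
            (mean (fun e => e ∉ dirFreeEdges ⌈β ^ θ⌉₊) dirCorner (2 * ⌈β ^ θ⌉₊ + 3) ((Real.sqrt 2)⁻¹ • ϑ c))) (x, 1, 2) ^ 2 =
      β * (∫ U, plaqCostAt ρ x 1 2 U ∂(boxKernelG ρ β ⌈β ^ θ⌉₊
        (forestFix ⌈β ^ θ⌉₊ (glueWith (boxEdgesAt dirCorner (2 * ⌈β ^ θ⌉₊ + 3))
          (fun e' : ↥(boxEdgesAt dirCorner (2 * ⌈β ^ θ⌉₊ + 3)) => gaugeTransformZd g ω e'.1) (fun _ => 1))))) -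
        ((dimE ρ : ℝ) / 2 * boxDirProjKernel ⌈β ^ θ⌉₊ (x, 1, 2) (x, 1, 2) +
          1 / 2 * ∑ c, (sCirc (glue (pin := fun e => e ∉ dirFreeEdges ⌈β ^ θ⌉₊) dirCorner (2 * ⌈β ^ θ⌉₊ + 3) (sdatE β ϑ c)
            (mean (fun e => e ∉ dirFreeEdges ⌈β ^ θ⌉₊) dirCorner (2 * ⌈β ^ θ⌉₊ + 3) (sdatE β ϑ c))) (x, 1, 2)) ^ 2) := by
    rw [hU1]; ring
  rw [hshape]
  refine hcore.trans (le_trans ?_ hfinal)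
  -- monotonicity in the tilt size: actual cards ≤ `120(2H+1)⁴`, `4(2H+1)⁴`
  have hw := tiltSize_le_cardBound ⌈β ^ θ⌉₊ hτ0 hℓ0
  have hexp := Real.exp_le_exp.2 (mul_le_mul_of_nonneg_left hw (by norm_num : (0 : ℝ) ≤ 2))
  have hM0 : 0 ≤ β ^ (2 * (6 * θ)) := by positivity
  have key := mul_le_mul_of_nonneg_left (sub_le_sub_right hexp 1) hM0
  linarith [key]

/-! ## Appended 2026-08-28 (same seat): the registered stub BY NAME, from p1's `eventually_kernelDatum_boundsG` -/

/-- A lattice representation of a compact SIMPLE group has positive degree: `IsSimpleCompactGroup` provides two non-commuting elements, and a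
faithful representation into the one-point type `Matrix (Fin 0) (Fin 0) ℂ` would make them commute. -/
theorem latticeRep_N_ne_zero (G : Type) [Group G] [TopologicalSpace G] [CompactSpace G] (hG : IsCompactSimpleLieGroup G)
    (r : LatticeRep G) : r.N ≠ 0 := by
  intro h0
  obtain ⟨⟨-, ⟨a, b, hab⟩, -⟩, -⟩ := hG
  haveI : IsEmpty (Fin r.N) := by rw [h0]; infer_instance
  exact hab (r.injective (Subsingleton.elim _ _))

/-- **Registered stub N2-mean-G `stub_kernelMeanExpansionG` of crux `BulkAllGroups` (stmt-QuantumFields-22255, skeleton v5), BY NAME and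
signature**, with `θ₂ = 1/200`: for every compact simple `G` and every `r : LatticeRep G`, for `0 < θ ≤ 1/200`, `KernelMeanExpansionG r.ρ θ (θ/5)` —
`kernelMeanExpansionG_of_bounds` (this file) with its numeric hypothesis discharged by p1's `eventually_kernelDatum_boundsG` (PLAN v6; the
scaled-background spelling `√β·√B = √(β·B)` and the trivial `r ≤ m` are bridged here). -/
theorem stub_kernelMeanExpansionG :
    ∀ (G : Type) [Group G] [TopologicalSpace G] [IsTopologicalGroup G] [CompactSpace G] [MeasurableSpace G] [BorelSpace G],
    IsCompactSimpleLieGroup G → ∀ r : LatticeRep G, ∃ θ₂ : ℝ, 0 < θ₂ ∧ ∀ θ : ℝ, 0 < θ → θ ≤ θ₂ →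
      KernelMeanExpansionG r.ρ θ (θ / 5) := by
  intro G _ _ _ _ _ _ hG r
  haveI : NeZero r.N := ⟨latticeRep_N_ne_zero G hG r⟩
  refine ⟨1 / 200, by norm_num, fun θ hθ hθ2 => ?_⟩
  refine kernelMeanExpansionG_of_bounds r.ρ r.continuous r.injective r.mem_unitary hθ (by linarith) ?_
  intro Ca CE r₂ C₂ η₀ hCa hCE hr₂ hC₂ hη₀
  filter_upwards [eventually_kernelDatum_boundsG r.N (dimE r.ρ) hCa hCE hr₂ hC₂ hη₀ hθ hθ2] with β h
  obtain ⟨hβ1, -, hL, hm4, hmr, hmEm, hwin, hP, -, hmean⟩ := h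
  have hβ0 : 0 < β := by linarith
  have hRp : Real.sqrt β * Real.sqrt (CE * (2 * (⌈β ^ θ⌉₊ : ℝ) + 3) ^ 4 * β ^ (2 * (θ / 5) - 1)) =
      Real.sqrt (β * (CE * (2 * (⌈β ^ θ⌉₊ : ℝ) + 3) ^ 4 * β ^ (2 * (θ / 5) - 1))) := (Real.sqrt_mul hβ0.le _).symm
  rw [hRp] at hmEm hwin hmean
  -- `r ≤ m = 2·(12H²+2H+1)(√2·√(β^{2ε−1}) + 8r)`
  have hX : 0 ≤ Ca * β ^ (3 * θ + θ / 5 - 1 / 2) := by positivity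
  have hS : 0 ≤ Real.sqrt 2 * Real.sqrt (β ^ (2 * (6 * θ) - 1)) := by positivity
  have hP1 : (1 : ℝ) ≤ 12 * (⌈β ^ θ⌉₊ : ℝ) ^ 2 + 2 * (⌈β ^ θ⌉₊ : ℝ) + 1 := by
    have : (0 : ℝ) ≤ (⌈β ^ θ⌉₊ : ℝ) := Nat.cast_nonneg _
    nlinarith
  have h1 : Real.sqrt 2 * Real.sqrt (β ^ (2 * (6 * θ) - 1)) + 8 * (Ca * β ^ (3 * θ + θ / 5 - 1 / 2)) ≤
      (12 * (⌈β ^ θ⌉₊ : ℝ) ^ 2 + 2 * (⌈β ^ θ⌉₊ : ℝ) + 1) *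
        (Real.sqrt 2 * Real.sqrt (β ^ (2 * (6 * θ) - 1)) + 8 * (Ca * β ^ (3 * θ + θ / 5 - 1 / 2))) :=
    le_mul_of_one_le_left (by positivity) hP1
  have hrm : Ca * β ^ (3 * θ + θ / 5 - 1 / 2) ≤
      2 * ((12 * (⌈β ^ θ⌉₊ : ℝ) ^ 2 + 2 * (⌈β ^ θ⌉₊ : ℝ) + 1) *
        (Real.sqrt 2 * Real.sqrt (β ^ (2 * (6 * θ) - 1)) + 8 * (Ca * β ^ (3 * θ + θ / 5 - 1 / 2)))) := by linarith
  exact ⟨hβ1, hL, hm4, hmr, hmEm, hrm, hwin, hP, hmean⟩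

end Summit.QuantumFields.YangMills.Theorems.ColdBoxAllGroups

end
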